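import Summits.Ventures.PercRepro.S1TriangleKernelFour
import Summits.Ventures.PercRepro.S1TriangleBoundSix

/-!
# PercRepro — THE BOOTSTRAPPED TRIANGLE COUNT RE-BASED AT NULLITY `4`: `s₃ ≤ triBound6 ν` under (C1) and (C2) (p8, gen 22;
a feeder for S4 — the top of the `q = 7` window, the row `42`)

The bootstrapped triangle count `s₃ ≤ triBound ν` (S1TriangleCountBoot) is a deletion induction at the point `x` on the
fewest triangles: `s₃ ≤ m + s₃(M ＼ {x})` and `2m(m − 1) ≤ 3·s₃(M ＼ {x})`, so `m ≤ tmax (s₃(M ＼ {x}))`. THE TRIANGLE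
KERNEL AT NULLITY `4` (S1TriangleKernelFour: `s₃ ≤ 6` under (C1) and (C2)) replaces the value `triBound 4 = 7` by `6`,
and the same induction from `ν = 4` on gives **`s₃ ≤ triBound6 ν`** (`ncard_triangles_le_triBound6`):
`0, 1, 2, 4, 6, 9, 13, 17, 22, 28, 35, 42, 50, 59, 68, …` — `22` against `24` at `ν = 8`. (C2) passes to the deletion
as (C1) does (`delete_singleton_eRk_eq`). Axioms: standard.
-/

open scoped Matroid

namespace PercRepro

namespace S1

open Set

variable {α : Type}

/-- **THE BOOTSTRAPPED TRIANGLE COUNT, RE-BASED AT NULLITY `4`.** If `|E| = r(E) + d`, every rank-`2` set has at most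
`3` elements (C1) and every rank-`≤ 3` set has at most `6` elements (C2), then `#(triangles M) ≤ triBound6 d`: for `d ≤ 3`
the bootstrapped count (`triBound6 d = triBound d`), for `d = 4` the kernel, for `d ≥ 5` the deletion induction at the
point `x` on the fewest triangles (`m := t_x`): `s₃ ≤ m + triBound6 (d − 1)` and `2m(m − 1) ≤ 3·triBound6 (d − 1)`, i.e.
`m ≤ tmax (triBound6 (d − 1))`. -/
theorem ncard_triangles_le_triBound6 (M : Matroid α) [M.Finite]
    (hC1 : ∀ L ⊆ M.E, M.eRk L = 2 → L.ncard ≤ 3)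
    (hC2 : ∀ X ⊆ M.E, M.eRk X ≤ 3 → X.ncard ≤ 6) {d : ℕ} (hd : M.E.encard = M.eRank + d) :
    (ThmN.triangles M).ncard ≤ triBound6 d := by
  suffices H : ∀ n : ℕ, ∀ (M : Matroid α) [M.Finite], M.E.ncard = n →
      (∀ L ⊆ M.E, M.eRk L = 2 → L.ncard ≤ 3) → (∀ X ⊆ M.E, M.eRk X ≤ 3 → X.ncard ≤ 6) →
      ∀ d : ℕ, M.E.encard = M.eRank + d → (ThmN.triangles M).ncard ≤ triBound6 d from
    H _ M rfl hC1 hC2 d hd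
  intro n
  induction n using Nat.strong_induction_on with
  | _ n ih =>
  intro M _ hn hC1 hC2 d hd
  classical
  -- small nullity: the bootstrapped count itself
  rcases Nat.lt_or_ge d 4 with hd4 | hd4
  · have h := ncard_triangles_le_triBound M hC1 hd
    have heq : triBound6 d = triBound d := by
      interval_cases d <;> rfl
    rw [heq]
    exact h
  rcases Nat.eq_or_lt_of_le hd4 with hd4' | hd5
  · -- nullity `4`: the kernel
    subst hd4'
    exact ncard_triangles_le_six_of_nullity_four M hC1 hC2 (by exact_mod_cast hd)
  -- nullity `≥ 5`: the deletion step
  set S := ThmN.triangles M with hS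
  have hSfin : S.Finite :=
    M.ground_finite.finite_subsets.subset (fun C hC => hC.1.subset_ground)
  by_cases hSe : S = ∅
  · rw [hSe, ncard_empty]; exact Nat.zero_le _
  -- the point on the fewest triangles
  have hUE : ⋃₀ S ⊆ M.E := by
    intro z hz
    obtain ⟨C, hC, hzC⟩ := Set.mem_sUnion.1 hz
    exact hC.1.subset_ground hzC
  have hUfin : (⋃₀ S).Finite := M.ground_finite.subset hUE
  set Uf : Finset α := hUfin.toFinset with hUf
  have hmemU : ∀ x, x ∈ Uf ↔ x ∈ ⋃₀ S := fun x => Set.Finite.mem_toFinset hUfin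
  have hUne : Uf.Nonempty := by
    obtain ⟨C₀, hC₀⟩ := nonempty_iff_ne_empty.2 hSe
    obtain ⟨e, heC₀⟩ := hC₀.1.nonempty
    exact ⟨e, (hmemU e).2 (Set.mem_sUnion.2 ⟨C₀, hC₀, heC₀⟩)⟩
  obtain ⟨x, hxU, hxmin⟩ := Finset.exists_min_image Uf (fun y => (ThmN.trianglesThrough M y).ncard) hUne
  have hxU' : x ∈ ⋃₀ S := (hmemU x).1 hxU
  obtain ⟨C₀, hC₀, hxC₀⟩ := Set.mem_sUnion.1 hxU'
  set m := (ThmN.trianglesThrough M x).ncard with hm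
  have hmin : ∀ y ∈ ⋃₀ ThmN.triangles M, m ≤ (ThmN.trianglesThrough M y).ncard :=
    fun y hy => hxmin y ((hmemU y).2 hy)
  have heE : x ∈ M.E := hC₀.1.subset_ground hxC₀
  have hne : ¬ M.IsColoop x := hC₀.1.not_isColoop_of_mem hxC₀
  have hx : M.IsNonloop x := by
    refine _root_.Matroid.isNonloop_of_not_isLoop heE ?_
    intro hloop
    have hC₀e : C₀ = {x} := hloop.eq_of_isCircuit_mem hC₀.1 hxC₀
    have := hC₀.2
    rw [hC₀e, ncard_singleton] at this
    omega
  -- the nullity of `M ＼ {x}` is `d − 1`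
  have hν : M✶.eRank = (d : ℕ∞) := by
    have h := _root_.Matroid.eRank_add_eRank_dual M
    rw [hd] at h
    exact WithTop.add_left_cancel (PercRepro.Matroid.eRank_ne_top_of_finite M) h
  have hdel := PercRepro.Matroid.dual_eRank_delete_singleton_add_one heE hne
  rw [hν] at hdel
  have hfin' : (M ＼ {x})✶.eRank ≠ ⊤ := by
    intro h
    rw [h] at hdel
    exact absurd hdel (by simp)
  obtain ⟨d', hd'⟩ := ENat.ne_top_iff_exists.1 hfin'
  have hdd' : d = d' + 1 := by
    rw [← hd'] at hdel
    exact_mod_cast hdel.symm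
  have hd'enc : (M ＼ {x}).E.encard = (M ＼ {x}).eRank + d' := by
    have h := _root_.Matroid.eRank_add_eRank_dual (M ＼ {x})
    rw [← hd'] at h
    exact h.symm
  have hdelE : (M ＼ {x}).E.ncard < n := by
    rw [_root_.Matroid.delete_ground, ← hn, ← ncard_sdiff_singleton_add_one heE M.ground_finite]
    omega
  have hC1' : ∀ L ⊆ (M ＼ {x}).E, (M ＼ {x}).eRk L = 2 → L.ncard ≤ 3 := by
    intro L hL hr
    rw [_root_.Matroid.delete_ground] at hL
    rw [delete_singleton_eRk_eq hL] at hr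
    exact hC1 L (hL.trans sdiff_subset) hr
  have hC2' : ∀ X ⊆ (M ＼ {x}).E, (M ＼ {x}).eRk X ≤ 3 → X.ncard ≤ 6 := by
    intro X hX hr
    rw [_root_.Matroid.delete_ground] at hX
    rw [delete_singleton_eRk_eq hX] at hr
    exact hC2 X (hX.trans sdiff_subset) hr
  -- (a) `s₃ ≤ m + triBound6 d'`
  set S₁ := ThmN.trianglesThrough M x with hS₁
  set S₂ := {C | M.IsCircuit C ∧ C.ncard = 3 ∧ x ∉ C} with hS₂
  have hsplit : S ⊆ S₁ ∪ S₂ := by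
    intro C hC
    by_cases h : x ∈ C
    · exact Or.inl ⟨hC.1, hC.2, h⟩
    · exact Or.inr ⟨hC.1, hC.2, h⟩
  have hS₁fin : S₁.Finite := hSfin.subset (fun C hC => ⟨hC.1, hC.2.1⟩)
  have hS₂fin : S₂.Finite := hSfin.subset (fun C hC => ⟨hC.1, hC.2.1⟩)
  have h3 : S.ncard ≤ S₁.ncard + S₂.ncard :=
    (ncard_le_ncard hsplit (hS₁fin.union hS₂fin)).trans (ncard_union_le _ _)
  have hsub : S₂ ⊆ ThmN.triangles (M ＼ {x}) := by
    intro C hC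
    exact ⟨_root_.Matroid.delete_isCircuit_iff.2 ⟨hC.1, disjoint_singleton_right.2 hC.2.2⟩, hC.2.1⟩
  have hS₂ : S₂.ncard ≤ triBound6 d' :=
    (ncard_le_ncard hsub
      ((M ＼ {x}).ground_finite.finite_subsets.subset (fun C hC => hC.1.subset_ground))).trans
      (ih _ hdelE (M ＼ {x}) rfl hC1' hC2' d' hd'enc)
  have ha : S.ncard ≤ m + triBound6 d' := by omega
  -- (b) `m(2m + 1) ≤ 3·s₃`
  have hstar : 1 + 2 * m ≤ (⋃₀ S).ncard := one_add_two_mul_ncard_trianglesThrough_le M hC1 hx hxU'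
  have hdc : (⋃₀ S).ncard * m ≤ 3 * S.ncard := ncard_sUnion_mul_le_three_mul_ncard_triangles M hmin
  have hb : m + 2 * m * m ≤ 3 * S.ncard := by
    have h1 : (1 + 2 * m) * m ≤ (⋃₀ S).ncard * m := Nat.mul_le_mul_right m hstar
    have h2 : (1 + 2 * m) * m = m + 2 * m * m := by ring
    rw [h2] at h1
    exact h1.trans hdc
  -- (c) `m ≤ tmax (triBound6 d')`
  have hc : 2 * m * m ≤ 2 * m + 3 * triBound6 d' := by
    have h1 : 3 * S.ncard ≤ 3 * m + 3 * triBound6 d' := by omega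
    omega
  have hmt : m ≤ tmax (triBound6 d') := le_tmax_of_le hc
  have hrec := triBound6_succ d' (by omega)
  subst hdd'
  omega

end S1

end PercRepro
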